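import Mathlib
import HarnessLib
import Literature.Geometry.DiscreteGeometry.LayerShellPatterns
import Summits.AtomisticToContinuum.Crystallization.Theorems.BrittleRungDescentSoftLayerPropagationPatternsHcp
import Summits.AtomisticToContinuum.Crystallization.Theorems.PricedLinkCensusSoftLayerPropagationStubBallPropagationHoles

/-!
# Local layer propagation without layers, FCC grain: one certified neighbour certifies the next

Route `BrittleRungDescent`, support item `SoftLayerPropagation` (stmt-AtomisticToContinuum-9210),
helper file (η = 0, vocabulary of `FejesTothKissingTwelve.lean`: unit balls, contact distance `2`;
uses `…Patterns.lean`, `…PatternsHcp.lean`).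

Inside an FCC grain of the packing `V` we call a centre `y` *certified* if its recentred shell
`kissingShell V y` IS a fixed FCC-arranged set `F` (one cuboctahedron for the whole grain).

* Facts on an FCC-arranged `F`: closed under `x ↦ −x` and under differences of touching points
  (`neg_mem_of_isArrangedIn_fcc`, `sub_mem_of_isArrangedIn_fcc`), every point lies in a contact
  triangle, the inner products of two points are `4, 2, 0, −2, −4`, two orthogonal points have a
  common neighbour (`decide` on the table `fccTab`).
* `kissingShell_add_eq_of_fcc` — **FCC step**: if `y ∈ V` is certified, `t ∈ F`, and the shell of
  the touching centre `y + t` is FCC-arranged, then `y + t` is certified (its shell contains the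
  closed star of `−t` in `F`, in particular a contact triangle of `F`;
  `eq_of_isArrangedIn_fcc_of_triangle`).
* `far_triple_of_hcp` — **HCP step**: if instead the shell of `y + t` is HCP-arranged, then it is
  `F` up to the far triple: for the unit normal `n` of its mirror plane on the side of `y`
  (`⟪−t, n⟫ = 𝗁`) every shell point is in `F` or at level `−𝗁` (`hcp_shell_far_triple`).

All statements are elementary ([folklore]).
-/

noncomputable section

namespace Summit.AtomisticToContinuum.Crystallization.Theorems

open Literature.Geometry.DiscreteGeometry Literature.MathematicalPhysics.StatisticalMechanics
open RealInnerProductSpace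

/-! ### Table facts -/

/-- Inner products of two cuboctahedron table vectors: `2, 1, 0, −1, −2`. [folklore] -/
theorem dotInt_fccTab_cases : ∀ i j : Fin 12,
    dotInt (fccTab i) (fccTab j) = 2 ∨ dotInt (fccTab i) (fccTab j) = 1 ∨ dotInt (fccTab i) (fccTab j) = 0 ∨
      dotInt (fccTab i) (fccTab j) = -1 ∨ dotInt (fccTab i) (fccTab j) = -2 := by
  decide

/-- Two orthogonal cuboctahedron vertices have a common neighbour. [folklore] -/
theorem fccTab_common_of_orthogonal : ∀ i j : Fin 12, dotInt (fccTab i) (fccTab j) = 0 →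
    ∃ k : Fin 12, fccAdj k i ∧ fccAdj k j := by
  decide

/-! ### FCC-arranged sets -/

section Arranged

variable {F : Set (EuclideanSpace ℝ (Fin 3))}

/-- An FCC-arranged set is centrally symmetric. [folklore] -/
theorem neg_mem_of_isArrangedIn_fcc (hF : IsArrangedIn F fccKissingPattern) {f : EuclideanSpace ℝ (Fin 3)}
    (hf : f ∈ F) : -f ∈ F := by
  obtain ⟨A, hA⟩ := isArrangedIn_fcc_iff_range.1 hF
  rw [hA] at hf ⊢
  exact neg_mem_of_fcc_range rfl hf

/-- In an FCC-arranged set the difference of two touching points is a point. [folklore] -/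
theorem sub_mem_of_isArrangedIn_fcc (hF : IsArrangedIn F fccKissingPattern) {f g : EuclideanSpace ℝ (Fin 3)}
    (hf : f ∈ F) (hg : g ∈ F) (hfg : dist f g = 2) : f - g ∈ F := by
  obtain ⟨A, hA⟩ := isArrangedIn_fcc_iff_range.1 hF
  rw [hA] at hf hg ⊢
  obtain ⟨i, rfl⟩ := hf
  obtain ⟨j, rfl⟩ := hg
  obtain ⟨m, hm⟩ := fccTab_sub_of_adj i j ((dist_map_fccRef_eq_two_iff A i j).1 hfg)
  exact ⟨m, by simp only [fccRef, hm, refPt_sub, map_sub]⟩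

/-- Points of an FCC-arranged set have norm `2`. [folklore] -/
theorem norm_eq_two_of_isArrangedIn_fcc (hF : IsArrangedIn F fccKissingPattern) {f : EuclideanSpace ℝ (Fin 3)}
    (hf : f ∈ F) : ‖f‖ = 2 :=
  hF.norm_eq_two (fun _ hp => norm_eq_one_of_mem_fccKissingPattern hp) hf

/-- Every point of an FCC-arranged set lies in a contact triangle of the set. [folklore] -/
theorem exists_triangle_of_isArrangedIn_fcc (hF : IsArrangedIn F fccKissingPattern)
    {t : EuclideanSpace ℝ (Fin 3)} (ht : t ∈ F) :
    ∃ f₁ ∈ F, ∃ f₂ ∈ F, dist t f₁ = 2 ∧ dist t f₂ = 2 ∧ dist f₁ f₂ = 2 := by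
  obtain ⟨A, hA⟩ := isArrangedIn_fcc_iff_range.1 hF
  rw [hA] at ht ⊢
  obtain ⟨i, rfl⟩ := ht
  obtain ⟨j, k, hij, hik, hjk⟩ := fccTab_exists_triangle i
  exact ⟨_, ⟨j, rfl⟩, _, ⟨k, rfl⟩, (dist_map_fccRef_eq_two_iff A i j).2 hij,
    (dist_map_fccRef_eq_two_iff A i k).2 hik, (dist_map_fccRef_eq_two_iff A j k).2 hjk⟩

/-- Inner products in an FCC-arranged set: `4, 2, 0, −2, −4`. [folklore] -/
theorem inner_cases_of_isArrangedIn_fcc (hF : IsArrangedIn F fccKissingPattern)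
    {f g : EuclideanSpace ℝ (Fin 3)} (hf : f ∈ F) (hg : g ∈ F) :
    ⟪f, g⟫ = 4 ∨ ⟪f, g⟫ = 2 ∨ ⟪f, g⟫ = 0 ∨ ⟪f, g⟫ = -2 ∨ ⟪f, g⟫ = -4 := by
  obtain ⟨A, hA⟩ := isArrangedIn_fcc_iff_range.1 hF
  rw [hA] at hf hg
  obtain ⟨i, rfl⟩ := hf
  obtain ⟨j, rfl⟩ := hg
  rw [A.inner_map_map, inner_fccRef]
  rcases dotInt_fccTab_cases i j with h | h | h | h | h <;> rw [h] <;> norm_num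

/-- Two orthogonal points of an FCC-arranged set have a common neighbour in the set. [folklore] -/
theorem exists_common_of_isArrangedIn_fcc (hF : IsArrangedIn F fccKissingPattern)
    {f g : EuclideanSpace ℝ (Fin 3)} (hf : f ∈ F) (hg : g ∈ F) (h0 : ⟪f, g⟫ = 0) :
    ∃ k ∈ F, dist k f = 2 ∧ dist k g = 2 := by
  obtain ⟨A, hA⟩ := isArrangedIn_fcc_iff_range.1 hF
  rw [hA] at hf hg ⊢
  obtain ⟨i, rfl⟩ := hf
  obtain ⟨j, rfl⟩ := hg
  have hd : dotInt (fccTab i) (fccTab j) = 0 := by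
    rw [A.inner_map_map, inner_fccRef] at h0
    have : (dotInt (fccTab i) (fccTab j) : ℝ) = 0 := by linarith
    exact_mod_cast this
  obtain ⟨k, hki, hkj⟩ := fccTab_common_of_orthogonal i j hd
  exact ⟨_, ⟨k, rfl⟩, (dist_map_fccRef_eq_two_iff A k i).2 hki, (dist_map_fccRef_eq_two_iff A k j).2 hkj⟩

end Arranged

/-! ### The two steps -/

section Steps

variable {V : Set (EuclideanSpace ℝ (Fin 3))} {F : Set (EuclideanSpace ℝ (Fin 3))}

/-- The closed star of `−t` is in the shell of `y + t`: the point `−t` … [folklore] -/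
theorem neg_mem_kissingShell_add {y t : EuclideanSpace ℝ (Fin 3)} (hyV : y ∈ V) (ht : ‖t‖ = 2) :
    -t ∈ kissingShell V (y + t) :=
  ⟨by simpa using hyV, by rw [norm_neg, ht]⟩

/-- … and `f − t` for every shell point `f` of `y` touching `t`. [folklore] -/
theorem sub_mem_kissingShell_add {y t f : EuclideanSpace ℝ (Fin 3)} (hf : f ∈ kissingShell V y)
    (hft : dist f t = 2) : f - t ∈ kissingShell V (y + t) :=
  ⟨by have : y + t + (f - t) = y + f := by abel
      rw [this]; exact hf.1, by rw [← dist_eq_norm, hft]⟩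

/-- **FCC step.**  Let the shell of `y ∈ V` be the FCC-arranged set `F`, let `t ∈ F`, and let the
shell of the touching centre `y + t` be FCC-arranged.  Then that shell is `F` too: it contains
`−t` and `fᵢ − t` for a contact triangle `t, f₁, f₂` of `F`, three points of `F` pairwise at distance
`2` (`eq_of_isArrangedIn_fcc_of_triangle`). [folklore] -/
theorem kissingShell_add_eq_of_fcc (hF : IsArrangedIn F fccKissingPattern) {y t : EuclideanSpace ℝ (Fin 3)}
    (hyV : y ∈ V) (hy : kissingShell V y = F) (ht : t ∈ F)
    (hx : IsArrangedIn (kissingShell V (y + t)) fccKissingPattern) : kissingShell V (y + t) = F := by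
  obtain ⟨f₁, hf₁, f₂, hf₂, h₁, h₂, h₁₂⟩ := exists_triangle_of_isArrangedIn_fcc hF ht
  have ht2 : ‖t‖ = 2 := norm_eq_two_of_isArrangedIn_fcc hF ht
  -- the three points, in the shell of `y + t` …
  have m0 : -t ∈ kissingShell V (y + t) := neg_mem_kissingShell_add hyV ht2
  have m1 : f₁ - t ∈ kissingShell V (y + t) := sub_mem_kissingShell_add (hy ▸ hf₁) (by rw [dist_comm]; exact h₁)
  have m2 : f₂ - t ∈ kissingShell V (y + t) := sub_mem_kissingShell_add (hy ▸ hf₂) (by rw [dist_comm]; exact h₂)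
  -- … and in `F`
  have n0 : -t ∈ F := neg_mem_of_isArrangedIn_fcc hF ht
  have n1 : f₁ - t ∈ F := sub_mem_of_isArrangedIn_fcc hF hf₁ ht (by rw [dist_comm]; exact h₁)
  have n2 : f₂ - t ∈ F := sub_mem_of_isArrangedIn_fcc hF hf₂ ht (by rw [dist_comm]; exact h₂)
  -- pairwise at distance `2`
  have d01 : dist (-t) (f₁ - t) = 2 := by
    rw [dist_eq_norm, show -t - (f₁ - t) = -f₁ by abel, norm_neg, norm_eq_two_of_isArrangedIn_fcc hF hf₁]
  have d02 : dist (-t) (f₂ - t) = 2 := by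
    rw [dist_eq_norm, show -t - (f₂ - t) = -f₂ by abel, norm_neg, norm_eq_two_of_isArrangedIn_fcc hF hf₂]
  have d12 : dist (f₁ - t) (f₂ - t) = 2 := by rw [dist_eq_norm, show f₁ - t - (f₂ - t) = f₁ - f₂ by abel, ← dist_eq_norm, h₁₂]
  exact eq_of_isArrangedIn_fcc_of_triangle hx hF m0 m1 m2 n0 n1 n2 d01 d02 d12

/-- **HCP step (the far triple).**  Let the shell of `y ∈ V` be the FCC-arranged set `F`, let
`t ∈ F`, and let the shell of `y + t` be HCP-arranged.  Then for some linear isometry `B`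
presenting that shell, with `n = B n₀` the unit normal of its mirror plane on the side of `y`
(`⟪−t, n⟫ = 𝗁`), every shell point of `y + t` lies in `F` or at level `−𝗁`. [folklore] -/
theorem far_triple_of_hcp (hF : IsArrangedIn F fccKissingPattern) {y t : EuclideanSpace ℝ (Fin 3)}
    (hyV : y ∈ V) (hy : kissingShell V y = F) (ht : t ∈ F)
    (hx : IsArrangedIn (kissingShell V (y + t)) hcpKissingPattern) :
    ∃ B : EuclideanSpace ℝ (Fin 3) →ₗᵢ[ℝ] EuclideanSpace ℝ (Fin 3),
      kissingShell V (y + t) = Set.range (fun i => B (hcpRef i)) ∧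
      ⟪-t, B ((Real.sqrt 3)⁻¹ • intVec ![1, 1, 1])⟫ = layerSpacing ∧
      ∀ q ∈ kissingShell V (y + t), q ∈ F ∨ ⟪q, B ((Real.sqrt 3)⁻¹ • intVec ![1, 1, 1])⟫ = -layerSpacing := by
  have ht2 : ‖t‖ = 2 := norm_eq_two_of_isArrangedIn_fcc hF ht
  refine hcp_shell_far_triple hx hF (neg_mem_kissingShell_add hyV ht2) (neg_mem_of_isArrangedIn_fcc hF ht) ?_
  intro f hf hft
  -- `f ∈ F` touching `−t`: `t + f = f − (−t) ∈ F`, so `y + (t + f) ∈ V`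
  have hmem : f - -t ∈ F := sub_mem_of_isArrangedIn_fcc hF hf (neg_mem_of_isArrangedIn_fcc hF ht) hft
  rw [sub_neg_eq_add] at hmem
  have hV' : y + (f + t) ∈ V := (hy ▸ hmem : f + t ∈ kissingShell V y).1
  refine ⟨?_, norm_eq_two_of_isArrangedIn_fcc hF hf⟩
  have : y + t + f = y + (f + t) := by abel
  rw [this]; exact hV'

end Steps

end Summit.AtomisticToContinuum.Crystallization.Theorems

end
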